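import Literature.Barriers.CriticalPhenomena.LaceExpansionKernelFourier
import HarnessLib

/-!
# Hara 2008, Lemma 2.1: the quadratic behaviour of `1 - Ĵ(k)` for a `ℤ^d`-symmetric kernel

Barrier catalogue `Literature/Barriers/CriticalPhenomena/` (D-0021), infrastructure for the two
remaining analytic named facts `Hara2008_lem22`, `Hara2008_lem23`
(`LaceExpansionGaussianLemmaAssembly.lean`) behind `Hara2008_thm13` and hence
`Hara2008_etaZeroXSpace`. All PROVED:

* isotropy of second moments of a `ℤ^d`-symmetric function (`tsum_apply_mul_apply_mul_eq_zero`,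
  `tsum_sq_apply_mul_eq`, `tsum_kdot_sq_mul`: `Σ_x (k·x)² f(x) = (|k|²/d) Σ_x |x|² f(x)`) — the
  "`ℤ^d`-symmetry" steps (2.30)–(2.31) of the proof of Lemma 2.1;
* Lemma 2.1 (2.9), upper half: `1 - Re Ĵ(k) ≤ K₂|k|²/(2d)` (`one_sub_re_latticeFT_le`; the lower
  half `0 ≤ 1 - Ĵ` is the infrared hypothesis (1.18) itself);
* the remainder: `|1 - Re Ĵ(k) - K₁|k|²/(2d)| ≤ (5/2)(Σ_x |x|^{2+θ}|J(x)|)|k|^{2+θ}`, `0 ≤ θ ≤ 2`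
  (`abs_one_sub_re_latticeFT_sub_le`) — the quantitative form "`|R̂₂(k)| ≤ (K₂'/2)|k|^{2+(ρ∧2)}`"
  of §2.6 (constant `5/2` from Mathlib's `Real.cos_bound` instead of Hara's `t⁴/24`), via the
  Hölder-type cosine bound `|1 - cos u - u²/2| ≤ (5/2)|u|^{2+θ}` and Cauchy–Schwarz
  `|k·x| ≤ |k||x|` (`knorm k = |k|`);
* `HaraKernelHyp.K0_le_K1` — "using `K₀ ≤ K₁`" (proof of Lemma 2.2): the infrared constant is at
  most the second moment.

Not here: the derivative bounds (2.10) of Lemma 2.1 (needed only for Lemma 2.3).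

## References

* T. Hara, Ann. Probab. 36 (2008) 530–593 (arXiv:math-ph/0504021): Lemma 2.1 ((2.9)–(2.10)) and
  its proof ((2.28)–(2.34)), §2.6 (improved bound on `R̂₂`), proof of Lemma 2.2 ("using
  `K₀ ≤ K₁`").
-/

noncomputable section

namespace Literature.Barriers.CriticalPhenomena

open MeasureTheory Filter Finset Literature.Probability.LatticeModels Literature.Probability.Percolation
open scoped Topology BigOperators

variable {d : ℕ}

/-! ### Second moments of a `ℤ^d`-symmetric function -/

/-- `|x_i x_j| ≤ |x|²`. [folklore] -/
theorem abs_apply_mul_apply_le (x : Site d) (i j : Fin d) :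
    |((x i : ℤ) : ℝ) * ((x j : ℤ) : ℝ)| ≤ euclidNorm x ^ 2 := by
  rw [abs_mul, sq]
  exact mul_le_mul (abs_apply_le_euclidNorm x i) (abs_apply_le_euclidNorm x j) (abs_nonneg _)
    (euclidNorm_nonneg x)

/-- The mixed second moments `Σ_x x_i x_j f(x)` are absolutely summable when `Σ|x|²|f| < ∞`.
[folklore] -/
theorem summable_apply_mul_apply_mul {f : Site d → ℝ} (hs : Summable fun x => euclidNorm x ^ 2 * |f x|)
    (i j : Fin d) : Summable fun x => ((x i : ℤ) : ℝ) * ((x j : ℤ) : ℝ) * f x := by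
  refine Summable.of_norm_bounded hs fun x => ?_
  rw [Real.norm_eq_abs, abs_mul]
  exact mul_le_mul_of_nonneg_right (abs_apply_mul_apply_le x i j) (abs_nonneg _)

/-- **Off-diagonal second moments vanish**: `Σ_x x_i x_j f(x) = 0` for `i ≠ j` and `f` invariant
under the reflection `x_i ↦ -x_i`. [cite: Hara2008, proof of Lemma 2.1 ("by ℤ^d-symmetry")] -/
theorem tsum_apply_mul_apply_mul_eq_zero {f : Site d → ℝ} (hf : IsZdSymmetric f) {i j : Fin d} (hij : i ≠ j) :
    ∑' x, ((x i : ℤ) : ℝ) * ((x j : ℤ) : ℝ) * f x = 0 := by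
  classical
  set ε : Fin d → ℤˣ := Function.update (fun _ => 1) i (-1) with hε
  set σ := Site.signedPerm (Equiv.refl (Fin d)) ε with hσ
  have hσi : ∀ x : Site d, σ x i = -x i := fun x => by
    simp [hσ, hε, Site.signedPerm_apply]
  have hσj : ∀ x : Site d, σ x j = x j := fun x => by
    simp [hσ, hε, Site.signedPerm_apply, Function.update_of_ne hij.symm]
  set g : Site d → ℝ := fun x => ((x i : ℤ) : ℝ) * ((x j : ℤ) : ℝ) * f x with hg
  have hneg : ∀ x, g (σ x) = -g x := fun x => by
    have hfx : f (σ x) = f x := hf _ _ x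
    simp only [hg]
    rw [hσi, hσj, hfx]; push_cast; ring
  have h1 : ∑' x, g x = ∑' x, g (σ x) := (Equiv.tsum_eq σ g).symm
  rw [tsum_congr hneg, tsum_neg] at h1
  linarith

/-- **Diagonal second moments are equal**: `Σ_x x_i² f(x) = Σ_x x_j² f(x)` for `f` invariant under
the transposition of coordinates `i, j`. [cite: Hara2008, proof of Lemma 2.1 ("by ℤ^d-symmetry")] -/
theorem tsum_sq_apply_mul_eq_of_symm {f : Site d → ℝ} (hf : IsZdSymmetric f) (i j : Fin d) :
    ∑' x, ((x i : ℤ) : ℝ) ^ 2 * f x = ∑' x, ((x j : ℤ) : ℝ) ^ 2 * f x := by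
  set σ := Site.signedPerm (Equiv.swap i j) (fun _ => (1 : ℤˣ)) with hσ
  have hσi : ∀ x : Site d, σ x i = x j := fun x => by
    simp [hσ, Site.signedPerm_apply, Equiv.symm_swap, Equiv.swap_apply_left]
  set g : Site d → ℝ := fun x => ((x i : ℤ) : ℝ) ^ 2 * f x with hg
  have h1 : ∑' x, g x = ∑' x, g (σ x) := (Equiv.tsum_eq σ g).symm
  rw [h1]
  refine tsum_congr fun x => ?_
  have hfx : f (σ x) = f x := hf _ _ x
  simp only [hg]
  rw [hσi, hfx]

/-- Hence each diagonal second moment is `d⁻¹ Σ_x |x|² f(x)` (`d ≥ 1`).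
[cite: Hara2008, proof of Lemma 2.1 (display (2.31))] -/
theorem tsum_sq_apply_mul_eq {f : Site d → ℝ} (hf : IsZdSymmetric f)
    (hs : Summable fun x => euclidNorm x ^ 2 * |f x|) (i : Fin d) :
    ∑' x, ((x i : ℤ) : ℝ) ^ 2 * f x = (∑' x, euclidNorm x ^ 2 * f x) / d := by
  rcases Nat.eq_zero_or_pos d with hd | hd
  · subst hd; exact i.elim0
  have hd0 : (d : ℝ) ≠ 0 := by exact_mod_cast hd.ne'
  have hsi : ∀ j : Fin d, Summable fun x => ((x j : ℤ) : ℝ) ^ 2 * f x := fun j => by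
    have := summable_apply_mul_apply_mul hs j j
    simpa [sq] using this
  have htot : ∑' x, euclidNorm x ^ 2 * f x = ∑ j : Fin d, ∑' x, ((x j : ℤ) : ℝ) ^ 2 * f x := by
    rw [← Summable.tsum_finsetSum (fun j _ => hsi j)]
    refine tsum_congr fun x => ?_
    rw [euclidNorm_sq, Finset.sum_mul]
  rw [htot, Finset.sum_congr rfl fun j _ => tsum_sq_apply_mul_eq_of_symm hf j i, Finset.sum_const,
    Finset.card_univ, Fintype.card_fin, nsmul_eq_mul]
  field_simp

/-- **The quadratic form of a `ℤ^d`-symmetric function is isotropic**: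
`Σ_x (k·x)² f(x) = (|k|²/d) Σ_x |x|² f(x)`. [cite: Hara2008, proof of Lemma 2.1 (displays (2.30)–(2.31))] -/
theorem tsum_kdot_sq_mul {f : Site d → ℝ} (hf : IsZdSymmetric f)
    (hs : Summable fun x => euclidNorm x ^ 2 * |f x|) (k : Fin d → ℝ) :
    ∑' x, kdot k x ^ 2 * f x = (∑ i, k i ^ 2) / d * ∑' x, euclidNorm x ^ 2 * f x := by
  classical
  have hsum : ∀ i j : Fin d, Summable fun x => k i * k j * (((x i : ℤ) : ℝ) * ((x j : ℤ) : ℝ) * f x) :=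
    fun i j => (summable_apply_mul_apply_mul hs i j).mul_left _
  have hexp : ∀ x : Site d, kdot k x ^ 2 * f x =
      ∑ i, ∑ j, k i * k j * (((x i : ℤ) : ℝ) * ((x j : ℤ) : ℝ) * f x) := by
    intro x
    rw [kdot, sq, Finset.sum_mul_sum, Finset.sum_mul]
    refine Finset.sum_congr rfl fun i _ => ?_
    rw [Finset.sum_mul]
    refine Finset.sum_congr rfl fun j _ => ?_
    ring
  rw [tsum_congr hexp, Summable.tsum_finsetSum (fun i _ => summable_sum fun j _ => hsum i j)]
  rw [Finset.sum_congr rfl fun i _ => Summable.tsum_finsetSum (fun j _ => hsum i j)]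
  -- only the diagonal survives
  have hdiag : ∀ i : Fin d, ∑ j, ∑' x, k i * k j * (((x i : ℤ) : ℝ) * ((x j : ℤ) : ℝ) * f x) =
      k i ^ 2 * ((∑' x, euclidNorm x ^ 2 * f x) / d) := by
    intro i
    rw [Finset.sum_eq_single i]
    · rw [tsum_mul_left, ← tsum_sq_apply_mul_eq hf hs i, sq]
      congr 1
      exact tsum_congr fun x => by ring
    · intro j _ hji
      rw [tsum_mul_left, tsum_apply_mul_apply_mul_eq_zero hf (Ne.symm hji), mul_zero]
    · intro h; exact absurd (Finset.mem_univ i) h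
  rw [Finset.sum_congr rfl fun i _ => hdiag i, ← Finset.sum_mul, div_mul_eq_mul_div, mul_div_assoc]


/-! ### Lemma 2.1: `0 ≤ 1 - Ĵ(k) ≤ K₂|k|²/(2d)` and `1 - Ĵ(k) = K₁|k|²/(2d) + R̂₂(k)` -/

/-- The Euclidean norm `|k| = (Σ_i k_i²)^{1/2}` on `k`-space. [cite: Hara2008, §1.1 Notation] -/
def knorm (k : Fin d → ℝ) : ℝ := Real.sqrt (∑ i, k i ^ 2)

/-- `|k| ≥ 0`. [folklore] -/
theorem knorm_nonneg (k : Fin d → ℝ) : 0 ≤ knorm k := Real.sqrt_nonneg _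

/-- `|k|² = Σ_i k_i²`. [folklore] -/
theorem knorm_sq (k : Fin d → ℝ) : knorm k ^ 2 = ∑ i, k i ^ 2 :=
  Real.sq_sqrt (Finset.sum_nonneg fun _ _ => sq_nonneg _)

/-- Cauchy–Schwarz: `|k·x| ≤ |k| |x|`. [folklore] -/
theorem abs_kdot_le (k : Fin d → ℝ) (x : Site d) : |kdot k x| ≤ knorm k * euclidNorm x := by
  have h := Finset.sum_mul_sq_le_sq_mul_sq Finset.univ (fun i => k i) (fun i => ((x i : ℤ) : ℝ))
  have h' : kdot k x ^ 2 ≤ (knorm k * euclidNorm x) ^ 2 := by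
    rw [mul_pow, knorm_sq, euclidNorm_sq]; exact h
  have := Real.sqrt_le_sqrt h'
  rwa [Real.sqrt_sq_eq_abs, Real.sqrt_sq (mul_nonneg (knorm_nonneg k) (euclidNorm_nonneg x))] at this

/-- `|J|` is `ℤ^d`-symmetric when `J` is. [folklore] -/
theorem IsZdSymmetric.abs {J : Site d → ℝ} (hJ : IsZdSymmetric J) : IsZdSymmetric fun x => |J x| :=
  fun π ε x => by simp only [hJ π ε x]

/-- **Lemma 2.1, (2.9), upper bound**: `1 - Re Ĵ(k) ≤ K₂|k|²/(2d)` with `K₂ = Σ_x |x|²|J(x)|`, for a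
`ℤ^d`-symmetric kernel with `Σ_x J(x) = 1` (`0 ≤ 1 - cos t ≤ t²/2` and the isotropy
`Σ_x (k·x)²|J(x)| = (|k|²/d) Σ_x |x|²|J(x)|`). [cite: Hara2008, Lemma 2.1 (2.9) with its proof ((2.28)–(2.30))] -/
theorem one_sub_re_latticeFT_le {J : Site d → ℝ} (hJs : IsZdSymmetric J) (hJ1 : HasSum J 1)
    (h2 : Summable fun x => euclidNorm x ^ 2 * |J x|) (k : Fin d → ℝ) :
    1 - (latticeFT J k).re ≤ (∑' x, euclidNorm x ^ 2 * |J x|) * (∑ i, k i ^ 2) / (2 * d) := by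
  have hJabs : Summable fun x => |J x| := hJ1.summable.abs
  rw [one_sub_re_latticeFT hJ1 hJabs k]
  have h2' : Summable fun x => euclidNorm x ^ 2 * |(fun y => |J y|) x| := by
    simpa only [abs_abs] using h2
  have hiso := tsum_kdot_sq_mul hJs.abs h2' k
  have hsum : Summable fun x => kdot k x ^ 2 * |J x| := by
    refine Summable.of_nonneg_of_le (fun x => by positivity) (fun x => ?_) (h2.mul_left (knorm k ^ 2))
    have h := abs_kdot_le k x
    calc kdot k x ^ 2 * |J x| = |kdot k x| ^ 2 * |J x| := by rw [sq_abs]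
      _ ≤ (knorm k * euclidNorm x) ^ 2 * |J x| := by gcongr
      _ = knorm k ^ 2 * (euclidNorm x ^ 2 * |J x|) := by ring
  calc ∑' x, J x * (1 - Real.cos (kdot k x)) ≤ ∑' x, kdot k x ^ 2 * |J x| / 2 := by
        refine Summable.tsum_le_tsum (fun x => ?_) ?_ (hsum.div_const 2)
        · have h1 : 0 ≤ 1 - Real.cos (kdot k x) := by linarith [Real.cos_le_one (kdot k x)]
          calc J x * (1 - Real.cos (kdot k x)) ≤ |J x| * (1 - Real.cos (kdot k x)) :=
                mul_le_mul_of_nonneg_right (le_abs_self _) h1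
            _ ≤ |J x| * (kdot k x ^ 2 / 2) := mul_le_mul_of_nonneg_left (one_sub_cos_le _) (abs_nonneg _)
            _ = kdot k x ^ 2 * |J x| / 2 := by ring
        · refine Summable.of_norm_bounded (hJabs.mul_right 2) fun x => ?_
          rw [Real.norm_eq_abs, abs_mul]
          refine mul_le_mul_of_nonneg_left ?_ (abs_nonneg _)
          rw [abs_le]; constructor <;> linarith [Real.cos_le_one (kdot k x), Real.neg_one_le_cos (kdot k x)]
    _ = (∑' x, kdot k x ^ 2 * |J x|) / 2 := tsum_div_const
    _ = (∑' x, euclidNorm x ^ 2 * |J x|) * (∑ i, k i ^ 2) / (2 * d) := by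
        rw [hiso]; ring

/-- **The cosine Taylor bound in Hölder form**: `|1 - cos u - u²/2| ≤ (5/2)|u|^{2+θ}` for
`0 ≤ θ ≤ 2` (from `|1 - cos t - t²/2| ≤ t²/2 ∧ t⁴/24`, here through Mathlib's `Real.cos_bound` on
`|u| ≤ 1` and the crude bound `2 + u²/2` beyond). [cite: Hara2008, proof of Lemma 2.1 (2.33)] -/
theorem abs_one_sub_cos_sub_sq_le (u : ℝ) {θ : ℝ} (hθ0 : 0 ≤ θ) (hθ2 : θ ≤ 2) :
    |1 - Real.cos u - u ^ 2 / 2| ≤ 5 / 2 * |u| ^ (2 + θ) := by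
  rcases (abs_nonneg u).eq_or_lt with h0 | h0
  · have hu : u = 0 := abs_eq_zero.1 h0.symm
    subst hu
    simp [Real.zero_rpow (by linarith : (2 : ℝ) + θ ≠ 0)]
  rcases le_or_gt |u| 1 with h | h
  · have hb := Real.cos_bound h
    have h4 : |u| ^ (4 : ℝ) ≤ |u| ^ (2 + θ) :=
      Real.rpow_le_rpow_of_exponent_ge h0 h (by linarith)
    have h4' : |u| ^ 4 = |u| ^ (4 : ℝ) := by norm_cast
    calc |1 - Real.cos u - u ^ 2 / 2| = |Real.cos u - (1 - u ^ 2 / 2)| := by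
          rw [← abs_neg]; congr 1; ring
      _ ≤ |u| ^ 4 * (5 / 96) := hb
      _ ≤ |u| ^ (2 + θ) * (5 / 96) := by rw [h4']; gcongr
      _ ≤ 5 / 2 * |u| ^ (2 + θ) := by
          have := Real.rpow_nonneg (abs_nonneg u) (2 + θ)
          nlinarith
  · have hu2 : |u| ^ (2 : ℝ) ≤ |u| ^ (2 + θ) := Real.rpow_le_rpow_of_exponent_le h.le (by linarith)
    have hu2' : u ^ 2 = |u| ^ (2 : ℝ) := by rw [← sq_abs]; norm_cast
    have h1 : |1 - Real.cos u - u ^ 2 / 2| ≤ 2 + u ^ 2 / 2 := by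
      rw [abs_le]; constructor <;> nlinarith [Real.cos_le_one u, Real.neg_one_le_cos u, sq_nonneg u]
    have h1' : 1 ≤ u ^ 2 := by
      have : 1 < |u| ^ 2 := by nlinarith
      rw [sq_abs] at this; exact this.le
    calc |1 - Real.cos u - u ^ 2 / 2| ≤ 2 + u ^ 2 / 2 := h1
      _ ≤ 5 / 2 * u ^ 2 := by nlinarith
      _ ≤ 5 / 2 * |u| ^ (2 + θ) := by rw [hu2']; gcongr

/-- **Lemma 2.1, the remainder `R̂₂`** (quantitative form of §2.6): for a `ℤ^d`-symmetric kernel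
with `Σ_x J(x) = 1` and `Σ_x |x|^{2+θ}|J(x)| < ∞` (`0 ≤ θ ≤ 2`),
`|1 - Re Ĵ(k) - K₁|k|²/(2d)| ≤ (5/2) (Σ_x |x|^{2+θ}|J(x)|) |k|^{2+θ}`, `K₁ = Σ_x |x|²J(x)`
("the error term `R̂₂(k)` of Lemma 2.1 now obeys `|R̂₂(k)| ≤ (K₂'/2)|k|^{2+(ρ∧2)}`").
[cite: Hara2008, Lemma 2.1 (2.9)–(2.31) and §2.6] -/
theorem abs_one_sub_re_latticeFT_sub_le {J : Site d → ℝ} (hJs : IsZdSymmetric J) (hJ1 : HasSum J 1)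
    (h2 : Summable fun x => euclidNorm x ^ 2 * |J x|) {θ : ℝ} (hθ0 : 0 ≤ θ) (hθ2 : θ ≤ 2)
    (hθs : Summable fun x => euclidNorm x ^ (2 + θ) * |J x|) (k : Fin d → ℝ) :
    |1 - (latticeFT J k).re - (∑' x, euclidNorm x ^ 2 * J x) * (∑ i, k i ^ 2) / (2 * d)| ≤
      5 / 2 * (∑' x, euclidNorm x ^ (2 + θ) * |J x|) * knorm k ^ (2 + θ) := by
  have hJabs : Summable fun x => |J x| := hJ1.summable.abs
  have hiso := tsum_kdot_sq_mul hJs h2 k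
  have hsq : Summable fun x => kdot k x ^ 2 * J x := by
    refine Summable.of_norm_bounded (h2.mul_left (knorm k ^ 2)) fun x => ?_
    rw [Real.norm_eq_abs, abs_mul]
    have h := abs_kdot_le k x
    calc |kdot k x ^ 2| * |J x| = |kdot k x| ^ 2 * |J x| := by rw [abs_pow]
      _ ≤ (knorm k * euclidNorm x) ^ 2 * |J x| := by gcongr
      _ = knorm k ^ 2 * (euclidNorm x ^ 2 * |J x|) := by ring
  have hcos : Summable fun x => J x * (1 - Real.cos (kdot k x)) := by
    refine Summable.of_norm_bounded (hJabs.mul_right 2) fun x => ?_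
    rw [Real.norm_eq_abs, abs_mul]
    refine mul_le_mul_of_nonneg_left ?_ (abs_nonneg _)
    rw [abs_le]; constructor <;> linarith [Real.cos_le_one (kdot k x), Real.neg_one_le_cos (kdot k x)]
  -- rewrite the left-hand side as a single series
  have hlhs : 1 - (latticeFT J k).re - (∑' x, euclidNorm x ^ 2 * J x) * (∑ i, k i ^ 2) / (2 * d) =
      ∑' x, J x * (1 - Real.cos (kdot k x) - kdot k x ^ 2 / 2) := by
    rw [one_sub_re_latticeFT hJ1 hJabs k]
    have h1 : (∑' x, euclidNorm x ^ 2 * J x) * (∑ i, k i ^ 2) / (2 * d) = ∑' x, kdot k x ^ 2 * J x / 2 := by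
      rw [tsum_div_const, hiso]; ring
    rw [h1, ← Summable.tsum_sub hcos (hsq.div_const 2)]
    exact tsum_congr fun x => by ring
  rw [hlhs]
  -- termwise bound
  have hpt : ∀ x, ‖J x * (1 - Real.cos (kdot k x) - kdot k x ^ 2 / 2)‖ ≤
      5 / 2 * knorm k ^ (2 + θ) * (euclidNorm x ^ (2 + θ) * |J x|) := by
    intro x
    rw [Real.norm_eq_abs, abs_mul]
    have h1 := abs_one_sub_cos_sub_sq_le (kdot k x) hθ0 hθ2
    have h2 : |kdot k x| ^ (2 + θ) ≤ (knorm k * euclidNorm x) ^ (2 + θ) :=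
      Real.rpow_le_rpow (abs_nonneg _) (abs_kdot_le k x) (by linarith)
    rw [Real.mul_rpow (knorm_nonneg k) (euclidNorm_nonneg x)] at h2
    calc |J x| * |1 - Real.cos (kdot k x) - kdot k x ^ 2 / 2| ≤ |J x| * (5 / 2 * |kdot k x| ^ (2 + θ)) := by
          gcongr
      _ ≤ |J x| * (5 / 2 * (knorm k ^ (2 + θ) * euclidNorm x ^ (2 + θ))) := by gcongr
      _ = 5 / 2 * knorm k ^ (2 + θ) * (euclidNorm x ^ (2 + θ) * |J x|) := by ring
  refine (tsum_of_norm_bounded (hθs.mul_left (5 / 2 * knorm k ^ (2 + θ))).hasSum hpt).trans (le_of_eq ?_)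
  rw [tsum_mul_left]; ring

/-- On the lattice `|x|^{2+θ}|J(x)| ≤ |x|^{2+ρ}|J(x)|` termwise for `θ ≤ ρ` (`|x| ≥ 1` or `x = 0`), so
the `(2+ρ)`-moment controls the `(2+θ)`-moment. [folklore] -/
theorem summable_rpow_mul_abs_of_le {J : Site d → ℝ} {θ ρ : ℝ} (hθ : 0 ≤ θ) (hθρ : θ ≤ ρ)
    (hs : Summable fun x => euclidNorm x ^ (2 + ρ) * |J x|) :
    Summable fun x => euclidNorm x ^ (2 + θ) * |J x| := by
  refine Summable.of_nonneg_of_le (fun x => mul_nonneg (Real.rpow_nonneg (euclidNorm_nonneg x) _)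
    (abs_nonneg _)) (fun x => ?_) hs
  refine mul_le_mul_of_nonneg_right ?_ (abs_nonneg _)
  by_cases hx : x = 0
  · subst hx; simp [Real.zero_rpow (by linarith : (2 : ℝ) + θ ≠ 0), Real.zero_rpow (by linarith : (2 : ℝ) + ρ ≠ 0)]
  · have h1 : 1 ≤ euclidNorm x := (one_le_norm_of_ne_zero hx).trans (norm_le_euclidNorm x)
    exact Real.rpow_le_rpow_of_exponent_le h1 (by linarith)

/-- **`K₀ ≤ K₁`** ("using `K₀ ≤ K₁`", proof of Lemma 2.2): the infrared lower bound
`K₀|k|²/(2d) ≤ 1 - Re Ĵ(k)` and the expansion `1 - Re Ĵ(k) = K₁|k|²/(2d) + O(|k|^{2+θ})`, `θ > 0`,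
force `K₀ ≤ K₁` (compare along `k = s e₁`, `s ↓ 0`). [cite: Hara2008, proof of Lemma 2.2 ("using K₀ ≤ K₁") and Lemma 2.1] -/
theorem HaraKernelHyp.K0_le_K1 {J : Site d → ℝ} {ρ : ℝ} (h : HaraKernelHyp d J ρ) (hd : 1 ≤ d)
    {K₀ : ℝ} (hlow : ∀ k ∈ cube d, K₀ * (∑ i, k i ^ 2) / (2 * d) ≤ 1 - (latticeFT J k).re) :
    K₀ ≤ ∑' x, euclidNorm x ^ 2 * J x := by
  set K₁ := ∑' x, euclidNorm x ^ 2 * J x with hK₁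
  set θ := min ρ 2 with hθ
  have hθ0 : 0 < θ := lt_min h.rho_pos two_pos
  have hθ2 : θ ≤ 2 := min_le_right _ _
  have hθs : Summable fun x => euclidNorm x ^ (2 + θ) * |J x| :=
    summable_rpow_mul_abs_of_le hθ0.le (min_le_left _ _) h.summable_rho
  set M := ∑' x, euclidNorm x ^ (2 + θ) * |J x| with hM
  have hM0 : 0 ≤ M := tsum_nonneg fun x => mul_nonneg (Real.rpow_nonneg (euclidNorm_nonneg x) _) (abs_nonneg _)
  have hd0 : (0 : ℝ) < d := by exact_mod_cast hd
  have i0 : Fin d := ⟨0, hd⟩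
  -- along `k = s e₁`: `K₀ s²/(2d) ≤ K₁ s²/(2d) + (5/2) M s^{2+θ}`
  have key : ∀ s : ℝ, 0 < s → s ≤ 1 → K₀ ≤ K₁ + 5 * d * M * s ^ θ := by
    intro s hs hs1
    have hsπ : |s| ≤ Real.pi := by rw [abs_of_pos hs]; linarith [Real.pi_gt_three]
    have hk := hlow (Pi.single i0 s) (single_mem_cube i0 hsπ)
    have hR := abs_one_sub_re_latticeFT_sub_le h.symm h.hasSum_one h.summable_sq hθ0.le hθ2 hθs (Pi.single i0 s)
    rw [sum_sq_single] at hk hR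
    have hkn : knorm (Pi.single i0 s : Fin d → ℝ) = s := by
      rw [knorm, sum_sq_single, Real.sqrt_sq hs.le]
    rw [hkn] at hR
    have hR' := (abs_le.1 hR).2
    have hs2 : s ^ (2 + θ) = s ^ 2 * s ^ θ := by
      rw [Real.rpow_add hs, show s ^ (2 : ℝ) = s ^ 2 by norm_cast]
    rw [hs2] at hR'
    -- divide by `s²/(2d) > 0`
    have hss : 0 < s ^ 2 := by positivity
    have h3 : K₀ * s ^ 2 / (2 * d) ≤ K₁ * s ^ 2 / (2 * d) + 5 / 2 * M * (s ^ 2 * s ^ θ) := by linarith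
    have h4 : K₀ * s ^ 2 ≤ (K₁ + 5 * d * M * s ^ θ) * s ^ 2 := by
      have := mul_le_mul_of_nonneg_right h3 (by positivity : (0 : ℝ) ≤ 2 * d)
      have e1 : K₀ * s ^ 2 / (2 * d) * (2 * d) = K₀ * s ^ 2 := by field_simp
      have e2 : (K₁ * s ^ 2 / (2 * d) + 5 / 2 * M * (s ^ 2 * s ^ θ)) * (2 * d) =
          (K₁ + 5 * d * M * s ^ θ) * s ^ 2 := by field_simp
      rw [e1, e2] at this; exact this
    exact le_of_mul_le_mul_right h4 hss
  -- let `s ↓ 0`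
  by_contra hlt
  rw [not_le] at hlt
  rcases eq_or_lt_of_le hM0 with hM00 | hMpos
  · have := key 1 one_pos le_rfl
    rw [← hM00] at this; simp at this; linarith
  · -- choose `s` with `5 d M s^θ < K₀ - K₁`
    set δ := (K₀ - K₁) / (10 * d * M) with hδ
    have hδ0 : 0 < δ := by rw [hδ]; exact div_pos (by linarith) (by positivity)
    set s := min 1 (δ ^ (1 / θ)) with hs
    have hs0 : 0 < s := lt_min one_pos (Real.rpow_pos_of_pos hδ0 _)
    have hs1 : s ≤ 1 := min_le_left _ _
    have hsθ : s ^ θ ≤ δ := by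
      have h1 : s ≤ δ ^ (1 / θ) := min_le_right _ _
      calc s ^ θ ≤ (δ ^ (1 / θ)) ^ θ := Real.rpow_le_rpow hs0.le h1 hθ0.le
        _ = δ := by rw [← Real.rpow_mul hδ0.le, one_div_mul_cancel hθ0.ne', Real.rpow_one]
    have := key s hs0 hs1
    have h2 : 5 * d * M * s ^ θ ≤ 5 * d * M * δ := by gcongr
    have h3 : 5 * d * M * δ = (K₀ - K₁) / 2 := by rw [hδ]; field_simp; ring
    linarith

end Literature.Barriers.CriticalPhenomena
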